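import Summits.HodgeConjecture.HodgeConjecture.Theorems.F0P3HilbertProjection
import Summits.HodgeConjecture.HodgeConjecture.Theorems.H413SpectrumJunction
import Literature.NumberTheory.Automorphic.AutomorphicSpectrum
import Mathlib.LinearAlgebra.Basis.VectorSpace
import HarnessLib

/-!
# Crux `H413`, line `F0_U3CohMultOne` — the FORM-LEVEL spectral projection `Φ ↦ Φ_P` from the representable letter TP⁺

Floor-0 programme P3 «U3-mult», seat F0P3-p02 (g0); crux item stmt-HodgeConjecture-24833 (`HCCMUnconditional.H413`).
HC_CM is proved only modulo the printed citations until rung 0 closes.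

The analytic letter (D) of the engine (lead's ruling, F0/P3 bus 2026-08-30T22:05:21Z (2)) is REPRESENTABILITY: for a discrete automorphic
`P ≤ L²(μ)` and a form `Φ` of a given type `A` (holomorphic cotangent, resp. its conjugate), the orthogonal projections onto `P` of the
`L²`-classes of the coordinates of `Φ` are the classes of the coordinates of SOME form `Φ_P` of the same type.  This file turns that ∃-statement
into the OBJECT the folds S3/S4 (p03), the junction J3 of ★ `Theorems/H413SpectrumJunction` (p04: its premise «`P.ContainsForm (ψ w)` for all
`w`») and programme P2's U2a consume — a `ℂ`-LINEAR, `G_f`-EQUIVARIANT form-level projection — with NO further analytic input: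

* `exists_formProjection` — for ANY unitary-datum `𝒰 = adelicGroupData F E c N J`, automorphic `μ` on a COMPACT quotient, discrete `P`, and a
  submodule `A` of `ℂ²`-valued forms which are left-`U(J)(F)`-invariant with continuous coordinates, stable under finite-adelic right translation
  (★ `CotangentForms.rightRep`) and REPRESENTABLE for `P` in the above sense: there is a linear `prF : X →ₗ[ℂ] X` with, for every `Φ ∈ A`,
  `prF Φ ∈ A`, the classes of the coordinates of `prF Φ` are the orthogonal projections onto `P` of those of `Φ` (so `P.ContainsForm (prF Φ)`),
  and `prF (R_g Φ) = R_g (prF Φ)`.  UNIQUENESS of `Φ_P` (the class map is injective on continuous forms, ★ `toLp_toQuotFun_ne_zero`: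
  `μ` is positive on open sets) gives well-definedness and linearity; equivariance is `pr_P ∘ R(g) = R(g) ∘ pr_P` (★
  `F0P3HilbertProjection.orthogonalProjectionOnto_map`, `rightRegular μ` being unitary) + the transport ★ `toLp_toQuotFun_mul_right`; the
  extension from `A` to all of `X` is Mathlib's `LinearMap.exists_extend`;
* `formProjection_ne_zero`-shape conjunct: if `P` is not orthogonal to the class of a coordinate of `Φ`, then `prF Φ ≠ 0`.

References: [BorelJacquet1979] A. Borel, H. Jacquet, Corvallis PSPM 33.1 §4.6 (the projections of `L²_d` onto its irreducible summands commute with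
`G(𝔸)`; `K`-finite `𝔷`-finite vectors are automorphic forms); [Dixmier1977] §13.1.
-/

-- the mandated namespace repeats `HodgeConjecture.HodgeConjecture`, as in every `Theorems/*.lean` of this sub-problem
set_option linter.dupNamespace false

noncomputable section

open MeasureTheory NumberField
open scoped InnerProductSpace ENNReal

namespace Summit.HodgeConjecture.HodgeConjecture.Cruxes.H413.F0P3FormProjection

open Literature.NumberTheory.Automorphic Literature.NumberTheory.Automorphic.UnitaryGroup
open Literature.NumberTheory.Automorphic.UnitaryGroup.CotangentForms (toQuotFun toQuotFun_mk rightRep)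
open Summit.HodgeConjecture.HodgeConjecture.Cruxes.H413.F0P3HilbertProjection
open Summit.HodgeConjecture.HodgeConjecture.Cruxes.H413.SpectrumJunction

variable {F E : Type} [Field F] [NumberField F] [Field E] [NumberField E] [Algebra F E]
  {c : E ≃ₐ[F] E} {N : ℕ} {J : Matrix (Fin N) (Fin N) E}
  {μ : Measure (adelicGroupData F E c N J).automorphicQuotient} [(adelicGroupData F E c N J).IsAutomorphicMeasure μ]
  [CompactSpace (adelicGroupData F E c N J).automorphicQuotient]

/-- The `L²`-class of the `j`-th coordinate of a left-invariant form with continuous coordinates (abbreviating term, not a definition: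
`(memLp_toQuotFun …).toLp _`). -/
theorem memLp_coord {Φ : (adelicGroupData F E c N J).Adelic → (Fin 2 → ℂ)}
    (hinv : ∀ γ ∈ (adelicGroupData F E c N J).quotientSubgroup, ∀ x, Φ (γ * x) = Φ x) (hcont : ∀ j : Fin 2, Continuous fun x => Φ x j)
    (j : Fin 2) : MemLp (toQuotFun (adelicGroupData F E c N J) fun x => Φ x j) 2 μ :=
  memLp_toQuotFun (fun γ hγ x => by simp only [hinv γ hγ x]) (hcont j) 2

/-- **Injectivity of the class map on continuous forms**: if all coordinate classes of a left-invariant form with continuous coordinates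
vanish, the form vanishes (`μ` is positive on open sets; ★ `toLp_toQuotFun_ne_zero`). [cite: BorelJacquet1979, §4.6] -/
theorem eq_zero_of_toLp_eq_zero {Φ : (adelicGroupData F E c N J).Adelic → (Fin 2 → ℂ)}
    (hinv : ∀ γ ∈ (adelicGroupData F E c N J).quotientSubgroup, ∀ x, Φ (γ * x) = Φ x) (hcont : ∀ j : Fin 2, Continuous fun x => Φ x j)
    (h0 : ∀ j : Fin 2, (memLp_coord (μ := μ) hinv hcont j).toLp _ = 0) : Φ = 0 := by
  funext x; funext j
  by_contra hne
  have hne' : (fun x => Φ x j) ≠ 0 := fun h => hne (by simpa using congrFun h x)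
  exact toLp_toQuotFun_ne_zero (fun γ hγ x => by simp only [hinv γ hγ x]) (hcont j) (memLp_coord hinv hcont j) hne' (h0 j)

/-- **THE FORM-LEVEL PROJECTION.**  Let `A` be a submodule of `ℂ²`-valued forms on `U(J)(𝔸_F)`, left-`U(J)(F)`-invariant with continuous
coordinates, stable under finite-adelic right translation, and REPRESENTABLE for the discrete `P`: for every `Φ ∈ A` some `Φ' ∈ A` has coordinate
classes `[Φ'_j] = pr_P [Φ_j]` (`pr_P` = `P.space.toSubmodule.starProjection`).  Then there is a `ℂ`-linear `prF` on all forms such that for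
`Φ ∈ A`: `prF Φ ∈ A`; `[(prF Φ)_j] = pr_P [Φ_j]` for both `j`; hence `P.ContainsForm (prF Φ)`; `prF (R_g Φ) = R_g (prF Φ)` for `g ∈ U(J)(𝔸_{F,f})`;
and `prF Φ ≠ 0` as soon as `P` is not orthogonal to some `[Φ_j]`. [cite: BorelJacquet1979, §4.6] [cite: Dixmier1977, §13.1] -/
theorem exists_formProjection (P : DiscreteAutomorphicRep (adelicGroupData F E c N J) μ)
    (A : Submodule ℂ ((adelicGroupData F E c N J).Adelic → (Fin 2 → ℂ)))
    (hinv : ∀ Φ ∈ A, ∀ γ ∈ (adelicGroupData F E c N J).quotientSubgroup, ∀ x, Φ (γ * x) = Φ x)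
    (hcont : ∀ Φ ∈ A, ∀ j : Fin 2, Continuous fun x => Φ x j)
    (hstab : ∀ (g : finAdelic F E c N J), ∀ Φ ∈ A, rightRep F E c N J g Φ ∈ A)
    (hrep : ∀ Φ (hΦ : Φ ∈ A), ∃ Φ', ∃ hΦ' : Φ' ∈ A, ∀ j : Fin 2,
      P.space.toSubmodule.starProjection ((memLp_coord (μ := μ) (hinv Φ hΦ) (hcont Φ hΦ) j).toLp _) =
        (memLp_coord (μ := μ) (hinv Φ' hΦ') (hcont Φ' hΦ') j).toLp _) :
    ∃ prF : ((adelicGroupData F E c N J).Adelic → (Fin 2 → ℂ)) →ₗ[ℂ] ((adelicGroupData F E c N J).Adelic → (Fin 2 → ℂ)),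
      (∀ Φ (hΦ : Φ ∈ A), ∃ hP : prF Φ ∈ A, ∀ j : Fin 2,
        P.space.toSubmodule.starProjection ((memLp_coord (μ := μ) (hinv Φ hΦ) (hcont Φ hΦ) j).toLp _) =
          (memLp_coord (μ := μ) (hinv _ hP) (hcont _ hP) j).toLp _) ∧
      (∀ Φ ∈ A, P.ContainsForm (prF Φ)) ∧
      (∀ (g : finAdelic F E c N J), ∀ Φ ∈ A, prF (rightRep F E c N J g Φ) = rightRep F E c N J g (prF Φ)) ∧
      (∀ Φ (hΦ : Φ ∈ A), (∃ j : Fin 2, ∃ u ∈ P.space,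
          ⟪(u : (adelicGroupData F E c N J).L2 μ), (memLp_coord (μ := μ) (hinv Φ hΦ) (hcont Φ hΦ) j).toLp _⟫_ℂ ≠ 0) → prF Φ ≠ 0) := by
  classical
  -- the class map of the `j`-th coordinate, as a LINEAR map on `A` (the `toLp` algebra lemmas are `rfl`)
  let clA : Fin 2 → (A →ₗ[ℂ] (adelicGroupData F E c N J).L2 μ) := fun j =>
    { toFun := fun Φ => (memLp_coord (μ := μ) (hinv Φ Φ.2) (hcont Φ Φ.2) j).toLp _
      map_add' := fun Φ Ψ => MemLp.toLp_add (memLp_coord (μ := μ) (hinv Φ Φ.2) (hcont Φ Φ.2) j)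
        (memLp_coord (μ := μ) (hinv Ψ Ψ.2) (hcont Ψ Ψ.2) j)
      map_smul' := fun r Φ => MemLp.toLp_const_smul r (memLp_coord (μ := μ) (hinv Φ Φ.2) (hcont Φ Φ.2) j) }
  have hclA : ∀ Φ (hΦ : Φ ∈ A) j, clA j ⟨Φ, hΦ⟩ = (memLp_coord (μ := μ) (hinv Φ hΦ) (hcont Φ hΦ) j).toLp _ := fun _ _ _ => rfl
  -- injectivity of the class map on `A`
  have huniq : ∀ Φ Ψ : A, (∀ j, clA j Φ = clA j Ψ) → Φ = Ψ := by
    intro Φ Ψ h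
    have h0 : ∀ j, clA j (Φ - Ψ) = 0 := fun j => by rw [map_sub, h j, sub_self]
    apply Subtype.ext
    have := eq_zero_of_toLp_eq_zero (μ := μ) (hinv _ (Φ - Ψ).2) (hcont _ (Φ - Ψ).2) h0
    exact sub_eq_zero.mp this
  -- the projection on `A`, by choice, and its characterisation
  have hrep' : ∀ Φ : A, ∃ Φ' : A, ∀ j, P.space.toSubmodule.starProjection (clA j Φ) = clA j Φ' := fun Φ => by
    obtain ⟨Φ', hΦ', h⟩ := hrep Φ Φ.2
    exact ⟨⟨Φ', hΦ'⟩, h⟩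
  let pr : A → A := fun Φ => (hrep' Φ).choose
  have hpr : ∀ Φ j, P.space.toSubmodule.starProjection (clA j Φ) = clA j (pr Φ) := fun Φ => (hrep' Φ).choose_spec
  have hchar : ∀ Φ Ψ : A, (∀ j, P.space.toSubmodule.starProjection (clA j Φ) = clA j Ψ) → pr Φ = Ψ :=
    fun Φ Ψ h => huniq _ _ fun j => by rw [← hpr, h j]
  -- linearity of `pr`
  let prA : A →ₗ[ℂ] A :=
    { toFun := pr
      map_add' := fun Φ Ψ => hchar _ _ fun j => by rw [map_add, map_add, hpr, hpr, map_add]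
      map_smul' := fun r Φ => hchar _ _ fun j => by rw [map_smul, map_smul, hpr, RingHom.id_apply, map_smul] }
  have hprA : ∀ Φ, prA Φ = pr Φ := fun _ => rfl
  -- extend `A.subtype ∘ prA` to all forms
  obtain ⟨prF, hprF⟩ := LinearMap.exists_extend (A.subtype ∘ₗ prA)
  have hprF_apply : ∀ Φ (hΦ : Φ ∈ A), prF Φ = ((prA ⟨Φ, hΦ⟩ : A) : (adelicGroupData F E c N J).Adelic → (Fin 2 → ℂ)) :=
    fun Φ hΦ => by
      have := LinearMap.congr_fun hprF ⟨Φ, hΦ⟩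
      simpa using this
  have hprF_mem : ∀ Φ (hΦ : Φ ∈ A), prF Φ ∈ A := fun Φ hΦ => by rw [hprF_apply Φ hΦ]; exact (prA ⟨Φ, hΦ⟩).2
  have hprF_eq : ∀ Φ (hΦ : Φ ∈ A), (⟨prF Φ, hprF_mem Φ hΦ⟩ : A) = pr ⟨Φ, hΦ⟩ :=
    fun Φ hΦ => Subtype.ext (hprF_apply Φ hΦ)
  -- classes of `prF Φ` are the projections of the classes of `Φ`
  have hclass : ∀ Φ (hΦ : Φ ∈ A) j, P.space.toSubmodule.starProjection (clA j ⟨Φ, hΦ⟩) = clA j ⟨prF Φ, hprF_mem Φ hΦ⟩ :=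
    fun Φ hΦ j => by rw [hprF_eq Φ hΦ, hpr]
  refine ⟨prF, fun Φ hΦ => ⟨hprF_mem Φ hΦ, fun j => hclass Φ hΦ j⟩, fun Φ hΦ j => ?_, fun g Φ hΦ => ?_, fun Φ hΦ hu => ?_⟩
  · -- `ContainsForm`
    refine ⟨memLp_coord (hinv _ (hprF_mem Φ hΦ)) (hcont _ (hprF_mem Φ hΦ)) j, ?_⟩
    rw [← hclA _ (hprF_mem Φ hΦ), ← hclass Φ hΦ j]
    exact Submodule.starProjection_apply_mem _ _
  · -- equivariance: both sides lie in `A` and have classes `R(1,g) pr_P [Φ_j]`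
    have hgΦ : rightRep F E c N J g Φ ∈ A := hstab g Φ hΦ
    have ht : ∀ Ψ (hΨ : Ψ ∈ A) (j : Fin 2), clA j ⟨rightRep F E c N J g Ψ, hstab g Ψ hΨ⟩ =
        (adelicGroupData F E c N J).rightRegular μ (finAdelicToAdelic F E c N J g) (clA j ⟨Ψ, hΨ⟩) := by
      intro Ψ hΨ j
      rw [hclA, hclA]
      exact toLp_toQuotFun_mul_right (fun γ hγ x => by simp only [hinv Ψ hΨ γ hγ x]) (finAdelicToAdelic F E c N J g)
        (memLp_coord (hinv Ψ hΨ) (hcont Ψ hΨ) j) _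
    have key : (⟨prF (rightRep F E c N J g Φ), hprF_mem _ hgΦ⟩ : A) =
        ⟨rightRep F E c N J g (prF Φ), hstab g _ (hprF_mem Φ hΦ)⟩ := by
      rw [hprF_eq _ hgΦ]
      refine hchar _ _ fun j => ?_
      rw [ht Φ hΦ j, ht (prF Φ) (hprF_mem Φ hΦ) j, ← hclass Φ hΦ j, Submodule.starProjection_apply,
        Submodule.starProjection_apply, orthogonalProjectionOnto_map ((adelicGroupData F E c N J).isUnitary_rightRegular μ)]
    exact congrArg Subtype.val key
  · -- non-vanishing
    obtain ⟨j, hu⟩ := hu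
    intro h0
    have h1 : clA j ⟨prF Φ, hprF_mem Φ hΦ⟩ = 0 := by
      have hz : (⟨prF Φ, hprF_mem Φ hΦ⟩ : A) = 0 := Subtype.ext h0
      rw [hz, map_zero]
    have h2 := hclass Φ hΦ j
    rw [h1, Submodule.starProjection_apply] at h2
    exact orthogonalProjectionOnto_ne_zero P.space hu (by exact_mod_cast h2)

end Summit.HodgeConjecture.HodgeConjecture.Cruxes.H413.F0P3FormProjection

end
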